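import Literature.AlgebraicGeometry.Modules.CechSheafRelativeAcyclic
import Literature.AlgebraicGeometry.Modules.PushforwardClosedImmersionCoh
import HarnessLib

/-!
# Direct images of Čech sheaves: `g_* Č•(g⁻¹𝓤, M') ≅ Č•(𝓤, g_*M')`, and `g_* Čⁿ(𝓤, M)` is quasi-coherent
# (affine-localizing) for a finite cover with faces affine over the base
# (Hartshorne III Prop. 8.7 (proof) and Lemma 4.2; The Stacks Project, Tags 02KE, 01XD)

Layer `Literature/AlgebraicGeometry/Modules`. Two bookkeeping facts about the sheaf Čech complex
`Č•(𝓤, M)` of `Modules/CechObjects` ∕ `CechResolution` (`Γ(V, Čⁿ(𝓤, M)) = Π_α Γ(M, V ∩ U_α)`) under direct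
images `g_* = Scheme.Modules.pushforward g` (`Γ(V, g_*M) = Γ(g⁻¹V, M)`):

* §1 **`Cech.pushforwardObjIso g U n M' : g_* Čⁿ(g⁻¹𝓤, M') ≅ Čⁿ(𝓤, g_*M')`** for any morphism `g : X ⟶ Y`, any
  family `𝓤` of opens of `Y` and any `𝒪_X`-module `M'` — both sides have sections
  `Π_α Γ(M', g⁻¹V ∩ g⁻¹U_α) = Π_α Γ(M', g⁻¹(V ∩ U_α))` (transport along the equality of opens
  `g⁻¹(V ∩ U_α) = g⁻¹V ∩ (g⁻¹𝓤)_α`); compatible with the Čech differentials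
  (**`Cech.pushforwardComplexIso`**: `g_* Č•(g⁻¹𝓤, M') ≅ Č•(𝓤, g_*M')` as cochain complexes).
* §2 **`Cech.isAffineLocalizing_pushforward_obj`**: for a morphism `g : X ⟶ Y`, a FINITE family `𝓤` of opens
  of `X` whose faces are affine over `Y` (`IsAffineHom ((face U β).ι ≫ g)`) and an affine-localizing
  (e.g. quasi-coherent) `M`, the `𝒪_Y`-module `g_* Čⁿ(𝓤, M)` is affine-localizing: over an affine `V ⊆ Y` its
  sections are the FINITE product `Π_α Γ(M, g⁻¹V ∩ U_α)` of sections of `M` over the affine opens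
  `g⁻¹V ∩ U_α`, and `g⁻¹D(r) ∩ U_α = D(r|)` is a basic open of `g⁻¹V ∩ U_α`, so numerators and torsion
  exponents are taken componentwise and bounded by their sum over the finitely many `α`
  (Hartshorne II Prop. 5.8 (c) pattern: `g_*` of a quasi-coherent module along the affine `g⁻¹V ∩ U_α → V`).

Everything PROVED; 0 named facts; no instances. Typed for the cell `pub-hodge-ring2` (brick (K4) «derived flat
base change»: `q^*(g_* Čⁿ)` is computed on affine charts by `Modules/PullbackAffineChart`, which needs
`g_* Čⁿ` affine-localizing); a research route conditional on HC_CM, not a corollary — nothing here refers to it.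

## References

* R. Hartshorne, *Algebraic Geometry*, GTM 52 (1977), III Lemma 4.2, III Prop. 8.7 (proof), II Prop. 5.8 (c).
  [Hartshorne1977]
* The Stacks Project, Tags 02KE (higher direct images via Čech complexes), 01XD. [StacksProject]
-/

noncomputable section

-- `TopCat.Presheaf`/`Scheme.Modules` are not reducible (as in Mathlib's `AlgebraicGeometry/Modules/Sheaf.lean`).
set_option backward.isDefEq.respectTransparency false

universe u

open CategoryTheory CategoryTheory.Limits Opposite TopologicalSpace AlgebraicGeometry

namespace Literature.AlgebraicGeometry.Modules

namespace Cech

variable {X Y : Scheme.{u}} (g : X ⟶ Y) {ι : Type u}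

/-! ### §1 `g_* Čⁿ(g⁻¹𝓤, M') ≅ Čⁿ(𝓤, g_*M')` -/

section Pushforward

variable (U : ι → Y.Opens) (n : ℕ) (M' : X.Modules)

/-- The pulled-back family `g⁻¹𝓤 = (g⁻¹U_i)_i`. [cite: Hartshorne1977, III Prop. 8.7 (proof)] -/
abbrev preimageFamily : ι → X.Opens := fun i => g ⁻¹ᵁ U i

/-- Faces of the pulled-back family are preimages of faces: `(g⁻¹𝓤)_α = g⁻¹(U_α)`.
[cite: Hartshorne1977, III Prop. 8.7 (proof)] -/
theorem face_preimageFamily {m : ℕ} (α : Fin (m + 1) → ι) : face (preimageFamily g U) α = g ⁻¹ᵁ face U α := by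
  apply le_antisymm
  · intro x hx
    change g.base x ∈ (face U α : Set Y)
    simp only [face, Opens.coe_iInf, Set.mem_iInter]
    intro k
    have hk : x ∈ (face (preimageFamily g U) α : X.Opens) := hx
    exact face_le (preimageFamily g U) α k hk
  · exact le_iInf fun k => g.preimage_mono (face_le U α k)

/-- `g⁻¹(V ∩ U_α) = g⁻¹V ∩ (g⁻¹𝓤)_α`. [cite: Hartshorne1977, III Prop. 8.7 (proof)] -/
theorem preimage_inf_face {m : ℕ} (V : Y.Opens) (α : Fin (m + 1) → ι) :
    g ⁻¹ᵁ (V ⊓ face U α) = g ⁻¹ᵁ V ⊓ face (preimageFamily g U) α := by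
  rw [face_preimageFamily]; rfl

/-- Restriction of sections of `g_*M'` is restriction of sections of `M'` along the preimages
(definitional; `Γ(V, g_*M') = Γ(g⁻¹V, M')`). [cite: Hartshorne1977, II §1 p. 65 (definition of `f_*`)] -/
theorem res_pushforward_obj {V W : Y.Opens} (h : W ≤ V) (t : Γ((Scheme.Modules.pushforward g).obj M', V)) :
    res ((Scheme.Modules.pushforward g).obj M') h t = res M' (g.preimage_mono h) (show Γ(M', g ⁻¹ᵁ V) from t) := rfl

/-- The image of `r ∈ Γ(Y, V)` in `Γ(X, O)` for `O ⊆ g⁻¹W ⊆ g⁻¹V` along either path (naturality of `g♯`).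
[cite: Hartshorne1977, II §2 p. 72 (morphisms of ringed spaces, `f♯` natural)] -/
theorem resO_app_eq {V W : Y.Opens} (hWV : W ≤ V) {O : X.Opens} (h₁ : O ≤ g ⁻¹ᵁ W) (h₂ : O ≤ g ⁻¹ᵁ V)
    (r : Γ(Y, V)) : resO (X := X) h₁ (g.app W (Y.presheaf.map (homOfLE hWV).op r)) = resO (X := X) h₂ (g.app V r) := by
  have h := ConcreteCategory.congr_hom (g.naturality (homOfLE hWV).op) r
  change g.app W (Y.presheaf.map (homOfLE hWV).op r) =
    resO (X := X) (g.preimage_mono hWV) (g.app V r) at h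
  rw [h, resO_resO]

/-- **`g_* Čⁿ(g⁻¹𝓤, M') ⟶ Čⁿ(𝓤, g_*M')`**: on sections over `V`, transport of
`(s_α ∈ Γ(M', g⁻¹V ∩ g⁻¹U_α))_α` to `(s_α ∈ Γ(M', g⁻¹(V ∩ U_α)))_α`. [cite: Hartshorne1977, III Prop. 8.7 (proof)] -/
def pushforwardObjHom :
    (Scheme.Modules.pushforward g).obj (obj (preimageFamily g U) n M') ⟶ obj U n ((Scheme.Modules.pushforward g).obj M') :=
  homMk (fun V s α => res M' (preimage_inf_face g U V α).le ((show Γ(obj (preimageFamily g U) n M', g ⁻¹ᵁ V) from s :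
      Sections (preimageFamily g U) n M' (g ⁻¹ᵁ V)) α))
    (fun V s t => funext fun α => by
      change res M' _ ((((show Γ(obj (preimageFamily g U) n M', g ⁻¹ᵁ V) from s) +
        (show Γ(obj (preimageFamily g U) n M', g ⁻¹ᵁ V) from t) : Γ(obj (preimageFamily g U) n M', g ⁻¹ᵁ V)) :
        Sections (preimageFamily g U) n M' (g ⁻¹ᵁ V)) α) = _
      rw [obj_add_apply, map_add]; rfl)
    (fun V r s => funext fun α => by
      rw [pushforward_smul g]
      change res M' _ (((g.app V r • (show Γ(obj (preimageFamily g U) n M', g ⁻¹ᵁ V) from s) :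
        Γ(obj (preimageFamily g U) n M', g ⁻¹ᵁ V)) : Sections (preimageFamily g U) n M' (g ⁻¹ᵁ V)) α) =
        resO (X := Y) (inf_le_left : V ⊓ face U α ≤ V) r •
          (show Γ((Scheme.Modules.pushforward g).obj M', V ⊓ face U α) from
            res M' (preimage_inf_face g U V α).le ((show Γ(obj (preimageFamily g U) n M', g ⁻¹ᵁ V) from s :
              Sections (preimageFamily g U) n M' (g ⁻¹ᵁ V)) α))
      rw [obj_smul_apply, res_smul, resO_resO, pushforward_smul g]
      congr 1
      exact (ConcreteCategory.congr_hom (g.naturality (homOfLE (inf_le_left : V ⊓ face U α ≤ V)).op) r).symm)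
    (fun V W i s => funext fun α => by
      rw [restrict_apply, res_pushforward_obj]
      change res M' _ (res M' _ ((show Γ(obj (preimageFamily g U) n M', g ⁻¹ᵁ V) from s :
        Sections (preimageFamily g U) n M' (g ⁻¹ᵁ V)) α)) = res M' _ (res M' _ _)
      rw [res_res, res_res])

/-- Components of `pushforwardObjHom`. [cite: Hartshorne1977, III Prop. 8.7 (proof)] -/
@[simp] theorem pushforwardObjHom_app_apply (V : Y.Opens)
    (s : Γ((Scheme.Modules.pushforward g).obj (obj (preimageFamily g U) n M'), V)) (α : Fin (n + 1) → ι) :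
    ((pushforwardObjHom g U n M').app V s : Sections U n ((Scheme.Modules.pushforward g).obj M') V) α =
      res M' (preimage_inf_face g U V α).le ((show Γ(obj (preimageFamily g U) n M', g ⁻¹ᵁ V) from s :
        Sections (preimageFamily g U) n M' (g ⁻¹ᵁ V)) α) := rfl

/-- `pushforwardObjHom` is bijective on sections (componentwise a transport along equal opens).
[cite: Hartshorne1977, III Prop. 8.7 (proof)] -/
theorem pushforwardObjHom_app_bijective (V : Y.Opens) : Function.Bijective ((pushforwardObjHom g U n M').app V) := by
  have key : ∀ α : Fin (n + 1) → ι, Function.Bijective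
      (res M' (preimage_inf_face g U V α).le : Γ(M', g ⁻¹ᵁ V ⊓ face (preimageFamily g U) α) → Γ(M', g ⁻¹ᵁ (V ⊓ face U α))) :=
    fun α => by
      have e : (homOfLE (preimage_inf_face g U V α).le) = (eqToIso (preimage_inf_face g U V α)).hom := Subsingleton.elim _ _
      change Function.Bijective (M'.presheaf.map (homOfLE (preimage_inf_face g U V α).le).op)
      rw [e]
      exact (M'.presheaf.mapIso (eqToIso (preimage_inf_face g U V α)).op).addCommGroupIsoToAddEquiv.bijective
  constructor
  · intro s t h
    have h' : ∀ α, res M' (preimage_inf_face g U V α).le ((show Γ(obj (preimageFamily g U) n M', g ⁻¹ᵁ V) from s :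
          Sections (preimageFamily g U) n M' (g ⁻¹ᵁ V)) α) =
        res M' (preimage_inf_face g U V α).le ((show Γ(obj (preimageFamily g U) n M', g ⁻¹ᵁ V) from t :
          Sections (preimageFamily g U) n M' (g ⁻¹ᵁ V)) α) := fun α => by
      have := congrFun (show ((pushforwardObjHom g U n M').app V s : Sections U n _ V) =
        ((pushforwardObjHom g U n M').app V t : Sections U n _ V) from h) α
      rwa [pushforwardObjHom_app_apply, pushforwardObjHom_app_apply] at this
    exact (show Function.Injective (fun x : Γ(obj (preimageFamily g U) n M', g ⁻¹ᵁ V) =>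
        (show Γ((Scheme.Modules.pushforward g).obj (obj (preimageFamily g U) n M'), V) from x)) from fun _ _ e => e)
      (funext fun α => (key α).1 (h' α))
  · intro t
    choose s hs using fun α => (key α).2 ((t : Sections U n ((Scheme.Modules.pushforward g).obj M') V) α)
    exact ⟨(show Γ((Scheme.Modules.pushforward g).obj (obj (preimageFamily g U) n M'), V) from
      (s : Sections (preimageFamily g U) n M' (g ⁻¹ᵁ V))), funext fun α => by rw [pushforwardObjHom_app_apply]; exact hs α⟩

/-- `pushforwardObjHom` is an isomorphism. [cite: Hartshorne1977, III Prop. 8.7 (proof)] -/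
theorem isIso_pushforwardObjHom : IsIso (pushforwardObjHom g U n M') :=
  isIso_of_bijective_app_of_isAffineOpen _ fun V _ => pushforwardObjHom_app_bijective g U n M' V

/-- **`g_* Čⁿ(g⁻¹𝓤, M') ≅ Čⁿ(𝓤, g_*M')`.** [cite: Hartshorne1977, III Prop. 8.7 (proof)] [cite: StacksProject, Tag 02KE] -/
def pushforwardObjIso :
    (Scheme.Modules.pushforward g).obj (obj (preimageFamily g U) n M') ≅ obj U n ((Scheme.Modules.pushforward g).obj M') :=
  haveI := isIso_pushforwardObjHom g U n M'
  asIso (pushforwardObjHom g U n M')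

/-- `pushforwardObjHom` commutes with the Čech differentials. [cite: Hartshorne1977, III Lemma 4.2 and Prop. 8.7 (proof)] -/
theorem pushforwardObjHom_d :
    (Scheme.Modules.pushforward g).map (d (preimageFamily g U) M' n) ≫ pushforwardObjHom g U (n + 1) M' =
      pushforwardObjHom g U n M' ≫ d U ((Scheme.Modules.pushforward g).obj M') n :=
  hom_ext_to fun V s α => by
    rw [Scheme.Modules.Hom.comp_app, CategoryTheory.comp_apply, pushforwardObjHom_app_apply,
      Scheme.Modules.pushforward_map_app, Scheme.Modules.Hom.comp_app, CategoryTheory.comp_apply, d_app_apply]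
    change res M' _ (((d (preimageFamily g U) M' n).app (g ⁻¹ᵁ V)
      (show Γ(obj (preimageFamily g U) n M', g ⁻¹ᵁ V) from s) : Sections (preimageFamily g U) (n + 1) M' (g ⁻¹ᵁ V)) α) = _
    rw [d_app_apply, map_sum]
    refine Finset.sum_congr rfl fun k _ => ?_
    rw [map_zsmul, res_res, pushforwardObjHom_app_apply, res_pushforward_obj]
    change _ = (-1 : ℤ) ^ (k : ℕ) • res M' _ (res M' _ _)
    rw [res_res]

/-- **`g_* Č•(g⁻¹𝓤, M') ≅ Č•(𝓤, g_*M')` as cochain complexes.** [cite: Hartshorne1977, III Prop. 8.7 (proof)] [cite: StacksProject, Tag 02KE] -/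
def pushforwardComplexIso :
    ((Scheme.Modules.pushforward g).mapHomologicalComplex (ComplexShape.up ℕ)).obj (complex (preimageFamily g U) M') ≅
      complex U ((Scheme.Modules.pushforward g).obj M') :=
  HomologicalComplex.Hom.isoOfComponents (fun n => pushforwardObjIso g U n M') fun i j hij => by
    obtain rfl : i + 1 = j := hij
    change pushforwardObjHom g U i M' ≫ (complex U ((Scheme.Modules.pushforward g).obj M')).d i (i + 1) =
      (Scheme.Modules.pushforward g).map ((complex (preimageFamily g U) M').d i (i + 1)) ≫ pushforwardObjHom g U (i + 1) M'
    rw [complex_d, complex_d]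
    exact (pushforwardObjHom_d g U i M').symm

/-- Components of `pushforwardComplexIso`. [cite: Hartshorne1977, III Prop. 8.7 (proof)] -/
@[simp] theorem pushforwardComplexIso_hom_f (k : ℕ) :
    (pushforwardComplexIso g U M').hom.f k = pushforwardObjHom g U k M' := rfl

end Pushforward

/-! ### §2 `g_* Čⁿ(𝓤, M)` is affine-localizing for a finite cover with faces affine over `Y` -/

section Localizing

variable (U : ι → X.Opens) (n : ℕ) [Finite ι]
  (hUaff : ∀ {m : ℕ} (β : Fin (m + 1) → ι), IsAffineHom ((face U β).ι ≫ g))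
include hUaff

omit [Finite ι] hUaff in
/-- `g⁻¹D(r) ∩ U_α = D(r|_{g⁻¹V ∩ U_α})` for `r ∈ Γ(Y, V)`. [cite: Hartshorne1977, II Prop. 5.8 (c) (proof)] -/
theorem preimage_basicOpen_inf_face {V : Y.Opens} (r : Γ(Y, V)) {m : ℕ} (α : Fin (m + 1) → ι) :
    g ⁻¹ᵁ Y.basicOpen r ⊓ face U α =
      X.basicOpen (X.presheaf.map (homOfLE (inf_le_left : g ⁻¹ᵁ V ⊓ face U α ≤ g ⁻¹ᵁ V)).op (g.app V r)) := by
  rw [Scheme.basicOpen_res, Scheme.preimage_basicOpen, inf_assoc, inf_comm (face U α), ← inf_assoc,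
    inf_eq_right.mpr (X.basicOpen_le _)]

/-- **`g_* Čⁿ(𝓤, M)` is affine-localizing** for `M` affine-localizing, `𝓤` a finite family whose faces are
affine over `Y`: sections over an affine `V` are `Π_α Γ(M, g⁻¹V ∩ U_α)` with `g⁻¹V ∩ U_α` affine and
`g⁻¹D(r) ∩ U_α = D(r|)`, so numerators ∕ torsion exponents exist componentwise and their sum over the finitely
many `α` works for all components at once. [cite: Hartshorne1977, II Prop. 5.8 (c)] [cite: StacksProject, Tag 02KE] -/
theorem isAffineLocalizing_pushforward_obj {M : X.Modules} (hM : IsAffineLocalizing M) :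
    IsAffineLocalizing ((Scheme.Modules.pushforward g).obj (obj U n M)) := by
  haveI : Fintype (Fin (n + 1) → ι) := Fintype.ofFinite _
  have hA : ∀ {V : Y.Opens} (_ : IsAffineOpen V) (α : Fin (n + 1) → ι), IsAffineOpen (g ⁻¹ᵁ V ⊓ face U α) :=
    fun hV α => isAffineOpen_preimage_inf_face U g hUaff hV α
  constructor
  · intro V hV r W hW s
    have hWV : W ≤ V := hW.le.trans (Y.basicOpen_le r)
    have hle : ∀ α : Fin (n + 1) → ι, g ⁻¹ᵁ W ⊓ face U α ≤ g ⁻¹ᵁ V ⊓ face U α := fun α =>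
      inf_le_inf_right _ (g.preimage_mono hWV)
    let rα : ∀ α : Fin (n + 1) → ι, Γ(X, g ⁻¹ᵁ V ⊓ face U α) := fun α =>
      resO (X := X) (inf_le_left : g ⁻¹ᵁ V ⊓ face U α ≤ g ⁻¹ᵁ V) (g.app V r)
    have hWα : ∀ α : Fin (n + 1) → ι, g ⁻¹ᵁ W ⊓ face U α = X.basicOpen (rα α) := fun α => by
      rw [hW]; exact preimage_basicOpen_inf_face g U r α
    -- componentwise numerators on the affine opens `g⁻¹V ∩ U_α`
    have hnum : ∀ α : Fin (n + 1) → ι, ∃ (k : ℕ) (x : Γ(M, g ⁻¹ᵁ V ⊓ face U α)),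
        res M (hle α) x = resO (X := X) (hle α) (rα α) ^ k • (show Γ(obj U n M, g ⁻¹ᵁ W) from s : Sections U n M (g ⁻¹ᵁ W)) α :=
      fun α => by
      obtain ⟨k, x, hx⟩ := hM.numerator (hA hV α) (rα α) (hWα α)
        ((show Γ(obj U n M, g ⁻¹ᵁ W) from s : Sections U n M (g ⁻¹ᵁ W)) α)
      refine ⟨k, x, ?_⟩
      have e : homOfLE ((hWα α).trans_le (X.basicOpen_le (rα α))) = homOfLE (hle α) := Subsingleton.elim _ _
      rw [e] at hx
      exact hx
    choose m x hx using hnum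
    let N : ℕ := ∑ α, m α
    have hmN : ∀ α, m α ≤ N := fun α => Finset.single_le_sum (fun β _ => Nat.zero_le (m β)) (Finset.mem_univ α)
    refine ⟨N, (show Γ((Scheme.Modules.pushforward g).obj (obj U n M), V) from
      (fun α => rα α ^ (N - m α) • x α : Sections U n M (g ⁻¹ᵁ V))), ?_⟩
    rw [pushforward_smul g]
    change (fun α => res M (hle α) (rα α ^ (N - m α) • x α) : Sections U n M (g ⁻¹ᵁ W)) =
      ((g.app W (Y.presheaf.map (homOfLE hWV).op r ^ N) • (show Γ(obj U n M, g ⁻¹ᵁ W) from s) :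
        Γ(obj U n M, g ⁻¹ᵁ W)) : Sections U n M (g ⁻¹ᵁ W))
    funext α
    rw [obj_smul_apply, res_smul, map_pow, hx α, ← mul_smul, ← pow_add, Nat.sub_add_cancel (hmN α), map_pow, map_pow,
      resO_app_eq g hWV inf_le_left ((hle α).trans inf_le_left) r]
    change resO (X := X) (hle α) (resO (X := X) inf_le_left (g.app V r)) ^ N • _ = _
    rw [resO_resO]
  · intro V hV r x W hWV hrW hx
    have hle : ∀ α : Fin (n + 1) → ι, g ⁻¹ᵁ W ⊓ face U α ≤ g ⁻¹ᵁ V ⊓ face U α := fun α =>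
      inf_le_inf_right _ (g.preimage_mono hWV)
    let rα : ∀ α : Fin (n + 1) → ι, Γ(X, g ⁻¹ᵁ V ⊓ face U α) := fun α =>
      resO (X := X) (inf_le_left : g ⁻¹ᵁ V ⊓ face U α ≤ g ⁻¹ᵁ V) (g.app V r)
    have hD : ∀ α : Fin (n + 1) → ι, X.basicOpen (rα α) ≤ g ⁻¹ᵁ W ⊓ face U α := fun α => by
      rw [← preimage_basicOpen_inf_face g U r α]
      exact inf_le_inf_right _ (g.preimage_mono hrW)
    have hxα : ∀ α : Fin (n + 1) → ι,
        M.presheaf.map (homOfLE (hle α)).op ((show Γ(obj U n M, g ⁻¹ᵁ V) from x : Sections U n M (g ⁻¹ᵁ V)) α) = 0 :=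
      fun α => congrFun (show ((show Γ(obj U n M, g ⁻¹ᵁ W) from
        ((Scheme.Modules.pushforward g).obj (obj U n M)).presheaf.map (homOfLE hWV).op x) : Sections U n M (g ⁻¹ᵁ W)) = 0
        from hx) α
    have htor := fun α : Fin (n + 1) → ι =>
      hM.torsion (hA hV α) (rα α) ((show Γ(obj U n M, g ⁻¹ᵁ V) from x : Sections U n M (g ⁻¹ᵁ V)) α) (hle α) (hD α) (hxα α)
    choose m hm using htor
    let N : ℕ := ∑ α, m α
    have hmN : ∀ α, m α ≤ N := fun α => Finset.single_le_sum (fun β _ => Nat.zero_le (m β)) (Finset.mem_univ α)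
    refine ⟨N, ?_⟩
    rw [pushforward_smul g]
    change ((g.app V (r ^ N) • (show Γ(obj U n M, g ⁻¹ᵁ V) from x) : Γ(obj U n M, g ⁻¹ᵁ V)) : Sections U n M (g ⁻¹ᵁ V)) = 0
    funext α
    rw [obj_smul_apply, map_pow, map_pow]
    change rα α ^ N • (show Γ(obj U n M, g ⁻¹ᵁ V) from x : Sections U n M (g ⁻¹ᵁ V)) α = 0
    rw [← Nat.sub_add_cancel (hmN α), pow_add, mul_smul, hm α, smul_zero]

end Localizing

end Cech

end Literature.AlgebraicGeometry.Modules

end
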